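import Mathlib
import Summits.Ventures.PercRepro2.Defs
import Summits.Ventures.PercRepro2.Independence
import Summits.Ventures.PercRepro2.Harris
import Summits.Ventures.PercRepro2.Graph
import Summits.Ventures.PercRepro2.Events
import Summits.Ventures.PercRepro2.Induced
import Summits.Ventures.PercRepro2.ObsIndependence
import Summits.Ventures.PercRepro2.VdBKahn
import Summits.Ventures.PercRepro2.BHK
import Summits.Ventures.PercRepro2.BHKEvents
import Summits.Ventures.PercRepro2.BHKAvoid
import Summits.Ventures.PercRepro2.BHKPair
import Summits.Ventures.PercRepro2.BHKAntitone

/-!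
# The antitone BHK corollary with FIBRE EVENTS (blind cell PercRepro2, mine-1 g53;
paper proofs/MINE1-BLOCKS.md §2.4, case `Z = ∅`)

`BHKAntitoneCross.bhk_two_cluster_four'` (g51) bounds products of probabilities of events
`{C_t ∈ 𝓤} ∩ {C_s ∈ 𝓥 ∩ 𝓦} ∩ {t ↮ X}` through the exploration of `C_t`, with `𝓥, 𝓦` families
of vertex sets (the cluster of the unexplored root).  The block family needs the same
inequality for events of the FIBRE `G ∖ C_t` that are not cluster events of `s` («every block is
reached by `s`, the blocks contracted»).  This file proves it for arbitrary increasing events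
`A` and decreasing events `B` of the fibre configuration `delConfig ends (C_t) ω`:

  `P(C_t ∈ 𝓤₁, G∖C_t ∈ A₁ ∩ B₁, t ↮ X) · P(C_t ∈ 𝓤₂, G∖C_t ∈ A₂ ∩ B₂, t ↮ Y)
     ≤ P(C_t ∈ 𝓤₁ ∩ 𝓤₂, G∖C_t ∈ B₁ ∩ B₂, t ↮ X ∩ Y) · P(G∖C_t ∈ A₁ ∩ A₂, t ↮ X ∪ Y)`

(`bhk_fibre_four`), by the same proof: the tower identity after exploring `C_t`
(`prob_clusterIn_inter_fibre_avoid_eq_expect`), Harris in the fibre, and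
`bhk_antitone_induced`.
-/

namespace Summit.Ventures.PercRepro2

namespace BHKFibre

section FibreDef

variable {V : Type*} {E : Type*} [Fintype E] [DecidableEq E] {R : Type*} [CommRing R]

/-- The fibre event: the configuration with the edges touching the cluster of `t` closed lies in
`A`. -/
def fibreEvent (ends : E → Sym2 V) (t : V) (A : Set (Config E)) : Set (Config E) :=
  {ω | delConfig ends (cluster ends ω t) ω ∈ A}

/-- `g_A(W) = P(G ∖ W ∈ A)`: the probability that the configuration with the edges touching `W`
closed lies in `A`. -/
noncomputable def delEventProb (p : E → R) (ends : E → Sym2 V) (A : Set (Config E)) (W : Set V) :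
    R :=
  prob p {ω | delConfig ends W ω ∈ A}

omit [Fintype E] [DecidableEq E] in
/-- `{G ∖ W ∈ A}` is an up-set for an up-set `A`. -/
lemma isUpperSet_del (ends : E → Sym2 V) {A : Set (Config E)} (hA : IsUpperSet A) (W : Set V) :
    IsUpperSet {ω : Config E | delConfig ends W ω ∈ A} :=
  fun _ _ hle hω => hA (BHKPair.delConfig_mono_config ends W hle) hω

omit [Fintype E] [DecidableEq E] in
/-- `{G ∖ W ∈ B}` is a down-set for a down-set `B`. -/
lemma isLowerSet_del (ends : E → Sym2 V) {B : Set (Config E)} (hB : IsLowerSet B) (W : Set V) :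
    IsLowerSet {ω : Config E | delConfig ends W ω ∈ B} :=
  fun _ _ hle hω => hB (BHKPair.delConfig_mono_config ends W hle) hω

variable [LinearOrder R] [IsStrictOrderedRing R] (p : E → R) (hp : IsProbVec p) (ends : E → Sym2 V)
include hp

/-- For an up-set `A`, `g_A` is antitone in `W`. -/
lemma delEventProb_anti {A : Set (Config E)} (hA : IsUpperSet A) :
    Antitone (delEventProb p ends A) := by
  intro W W' h
  unfold delEventProb
  exact prob_mono hp fun ω hω => hA (delConfig_anti h ω) hω

/-- For a down-set `B`, `g_B` is monotone in `W`. -/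
lemma delEventProb_mono {B : Set (Config E)} (hB : IsLowerSet B) :
    Monotone (delEventProb p ends B) := by
  intro W W' h
  unfold delEventProb
  exact prob_mono hp fun ω hω => hB (delConfig_anti h ω) hω

/-- `0 ≤ g`. -/
lemma delEventProb_nonneg (A : Set (Config E)) (W : Set V) : 0 ≤ delEventProb p ends A W :=
  prob_nonneg hp _

/-- **Harris in the fibre, up-sets**: `g_{A₁} g_{A₂} ≤ g_{A₁ ∩ A₂}`. -/
lemma delEventProb_mul_le_inter {A₁ A₂ : Set (Config E)} (h₁ : IsUpperSet A₁)
    (h₂ : IsUpperSet A₂) (W : Set V) :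
    delEventProb p ends A₁ W * delEventProb p ends A₂ W ≤ delEventProb p ends (A₁ ∩ A₂) W := by
  unfold delEventProb
  refine (prob_mul_prob_le_prob_inter hp (isUpperSet_del ends h₁ W)
    (isUpperSet_del ends h₂ W)).trans (le_of_eq ?_)
  congr 1

/-- **Harris in the fibre, down-sets**: `g_{B₁} g_{B₂} ≤ g_{B₁ ∩ B₂}`. -/
lemma delEventProb_mul_le_inter_of_isLowerSet {B₁ B₂ : Set (Config E)} (h₁ : IsLowerSet B₁)
    (h₂ : IsLowerSet B₂) (W : Set V) :
    delEventProb p ends B₁ W * delEventProb p ends B₂ W ≤ delEventProb p ends (B₁ ∩ B₂) W := by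
  unfold delEventProb
  refine (prob_mul_prob_le_prob_inter_of_isLowerSet hp (isLowerSet_del ends h₁ W)
    (isLowerSet_del ends h₂ W)).trans (le_of_eq ?_)
  congr 1

/-- **Harris in the fibre, mixed**: `g_{A ∩ B} ≤ g_A g_B` for an up-set `A` and a down-set `B`. -/
lemma delEventProb_inter_le_mul {A B : Set (Config E)} (hA : IsUpperSet A) (hB : IsLowerSet B)
    (W : Set V) :
    delEventProb p ends (A ∩ B) W ≤ delEventProb p ends A W * delEventProb p ends B W := by
  unfold delEventProb
  have h := prob_inter_le_prob_mul_prob_of_isLowerSet hp (isLowerSet_del ends hB W)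
    (isUpperSet_del ends hA W)
  rw [mul_comm] at h
  refine le_of_eq_of_le ?_ h
  congr 1
  ext ω
  simp only [Set.mem_setOf_eq, Set.mem_inter_iff]
  tauto

end FibreDef

section Exploration

variable {V : Type*} {E : Type*} [Fintype E] [DecidableEq E] [Fintype V] {R : Type*} [CommRing R]

/-- **Exploring the cluster of `t`, fibre form**: for a family `𝓤` of vertex sets, an event `A`
of the fibre and an avoided set `X`,
`P(C_t ∈ 𝓤, G ∖ C_t ∈ A, t ↮ X) = E[1_𝓤(C_t) · g_A(C_t) · 1_{t↮X}]`. -/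
theorem prob_clusterIn_inter_fibre_avoid_eq_expect (p : E → R) (ends : E → Sym2 V) (t : V)
    (X : Finset V) (𝓤 : Set (Set V)) (A : Set (Config E)) :
    prob p (clusterInEvent ends t 𝓤 ∩ fibreEvent ends t A ∩ avoidAll ends t X) =
      expect p (fun ω => 𝓤.indicator 1 (cluster ends ω t) *
        delEventProb p ends A (cluster ends ω t) * (avoidAll ends t X).indicator 1 ω) := by
  classical
  let 𝓐 : Set (Set V) := {W | ∀ x ∈ X, x ∉ W}
  have hA : ∀ ω, ω ∈ avoidAll ends t X ↔ cluster ends ω t ∈ 𝓐 := fun ω => Iff.rfl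
  let c : Set V → R := fun W => 𝓤.indicator 1 W * 𝓐.indicator 1 W
  let D : Set V → Config E → R := fun W =>
    ({ω | delConfig ends W ω ∈ A} : Set (Config E)).indicator 1
  let Φ : Set V → Config E → R := fun W ω => c W * D W ω
  have hΦ : ∀ W, DependsOn (Φ W) (touches ends W)ᶜ := by
    intro W ω ω' h
    simp only [Φ, D]
    congr 1
    refine dependsOn_indicator (R := R) (fun ω ω' h => ?_) h
    show (delConfig ends W ω ∈ A) = (delConfig ends W ω' ∈ A)
    rw [delConfig_congr h]
  have hS : ∀ W : Set V, DependsOn (· ∈ {ω | cluster ends ω t = W}) (touches ends W) :=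
    fun W => dependsOn_clusterEvent ends t W
  have hdisj : ∀ W : Set V, Disjoint (touches ends W) (touches ends W)ᶜ :=
    fun W => disjoint_compl_right
  have hpt : ∀ ω, (clusterInEvent ends t 𝓤 ∩ fibreEvent ends t A ∩
      avoidAll ends t X).indicator (1 : Config E → R) ω = Φ (cluster ends ω t) ω := by
    intro ω
    simp only [Φ, c, D]
    have hmem : ω ∈ {ω' | delConfig ends (cluster ends ω t) ω' ∈ A} ↔ ω ∈ fibreEvent ends t A :=
      Iff.rfl
    by_cases hav : ω ∈ avoidAll ends t X
    · rw [Set.indicator_of_mem (show cluster ends ω t ∈ 𝓐 from (hA ω).1 hav)]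
      by_cases h𝓤 : cluster ends ω t ∈ 𝓤
      · rw [Set.indicator_of_mem h𝓤]
        by_cases hF : ω ∈ fibreEvent ends t A
        · rw [Set.indicator_of_mem (show ω ∈ clusterInEvent ends t 𝓤 ∩ fibreEvent ends t A ∩
              avoidAll ends t X from ⟨⟨h𝓤, hF⟩, hav⟩), Set.indicator_of_mem (hmem.2 hF)]
          simp
        · rw [Set.indicator_of_notMem (show ω ∉ clusterInEvent ends t 𝓤 ∩ fibreEvent ends t A ∩
              avoidAll ends t X from fun h => hF h.1.2),
            Set.indicator_of_notMem (fun h => hF (hmem.1 h))]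
          simp
      · rw [Set.indicator_of_notMem (show ω ∉ clusterInEvent ends t 𝓤 ∩ fibreEvent ends t A ∩
            avoidAll ends t X from fun h => h𝓤 h.1.1), Set.indicator_of_notMem h𝓤]
        simp
    · rw [Set.indicator_of_notMem (show ω ∉ clusterInEvent ends t 𝓤 ∩ fibreEvent ends t A ∩
          avoidAll ends t X from fun h => hav h.2),
        Set.indicator_of_notMem (show cluster ends ω t ∉ 𝓐 from fun h => hav ((hA ω).2 h))]
      simp
  have hΦexp : ∀ W, expect p (Φ W) = c W * delEventProb p ends A W := by
    intro W
    simp only [Φ, D]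
    rw [expect_const_mul, ← prob_eq_expect_indicator]
    rfl
  rw [prob_eq_expect_indicator]
  have e1 : (clusterInEvent ends t 𝓤 ∩ fibreEvent ends t A ∩
      avoidAll ends t X).indicator (1 : Config E → R) = fun ω => Φ (cluster ends ω t) ω :=
    funext hpt
  rw [e1, expect_tower p hdisj (S := fun ω => cluster ends ω t) hS hΦ]
  simp only [hΦexp]
  unfold expect
  refine Finset.sum_congr rfl fun ω _ => ?_
  simp only [c]
  by_cases hav : ω ∈ avoidAll ends t X
  · rw [Set.indicator_of_mem (show cluster ends ω t ∈ 𝓐 from (hA ω).1 hav),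
      Set.indicator_of_mem hav]
    simp
  · rw [Set.indicator_of_notMem (show cluster ends ω t ∉ 𝓐 from fun h => hav ((hA ω).2 h)),
      Set.indicator_of_notMem hav]
    simp

end Exploration

section Four

variable {V : Type*} {E : Type*} [Fintype E] [DecidableEq E] [Fintype V] [DecidableEq V]
  {R : Type*} [CommRing R] [LinearOrder R] [IsStrictOrderedRing R]

/-- **The two-cluster four-functions inequality with fibre events**: for up-sets `𝓤₁, 𝓤₂` of the
explored cluster `C_t`, up-sets `A₁, A₂` and down-sets `B₁, B₂` of the fibre `G ∖ C_t`, and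
avoided sets `X, Y`,
`P(C_t ∈ 𝓤₁, G∖C_t ∈ A₁∩B₁, t↮X) · P(C_t ∈ 𝓤₂, G∖C_t ∈ A₂∩B₂, t↮Y)
  ≤ P(C_t ∈ 𝓤₁∩𝓤₂, G∖C_t ∈ B₁∩B₂, t↮X∩Y) · P(G∖C_t ∈ A₁∩A₂, t↮X∪Y)`. -/
theorem bhk_fibre_four (p : E → R) (hp : IsProbVec p) (ends : E → Sym2 V) (t : V)
    (X Y : Finset V) {𝓤₁ 𝓤₂ : Set (Set V)} (h𝓤₁ : IsUpperSet 𝓤₁) (h𝓤₂ : IsUpperSet 𝓤₂)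
    {A₁ A₂ B₁ B₂ : Set (Config E)} (hA₁ : IsUpperSet A₁) (hA₂ : IsUpperSet A₂)
    (hB₁ : IsLowerSet B₁) (hB₂ : IsLowerSet B₂) :
    prob p (clusterInEvent ends t 𝓤₁ ∩ fibreEvent ends t (A₁ ∩ B₁) ∩ avoidAll ends t X) *
        prob p (clusterInEvent ends t 𝓤₂ ∩ fibreEvent ends t (A₂ ∩ B₂) ∩ avoidAll ends t Y) ≤
      prob p (clusterInEvent ends t (𝓤₁ ∩ 𝓤₂) ∩ fibreEvent ends t (B₁ ∩ B₂) ∩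
          avoidAll ends t (X ∩ Y)) *
        prob p (fibreEvent ends t (A₁ ∩ A₂) ∩ avoidAll ends t (X ∪ Y)) := by
  classical
  have e1 := prob_clusterIn_inter_fibre_avoid_eq_expect p ends t X 𝓤₁ (A₁ ∩ B₁)
  have e2 := prob_clusterIn_inter_fibre_avoid_eq_expect p ends t Y 𝓤₂ (A₂ ∩ B₂)
  have e3 := prob_clusterIn_inter_fibre_avoid_eq_expect p ends t (X ∩ Y) (𝓤₁ ∩ 𝓤₂) (B₁ ∩ B₂)
  have e4 := prob_clusterIn_inter_fibre_avoid_eq_expect p ends t (X ∪ Y) Set.univ (A₁ ∩ A₂)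
  simp only [Set.indicator_univ, Pi.one_apply, one_mul] at e4
  have e4' : clusterInEvent ends t Set.univ ∩ fibreEvent ends t (A₁ ∩ A₂) ∩
      avoidAll ends t (X ∪ Y) = fibreEvent ends t (A₁ ∩ A₂) ∩ avoidAll ends t (X ∪ Y) := by
    ext ω; simp [clusterInEvent]
  rw [e4'] at e4
  have nI : ∀ (𝓤 : Set (Set V)) (W : Set V), 0 ≤ 𝓤.indicator (1 : Set V → R) W :=
    fun 𝓤 W => Set.indicator_apply_nonneg fun _ => zero_le_one
  have nA : ∀ (A : Set (Config E)) (ω : Config E), 0 ≤ A.indicator (1 : Config E → R) ω :=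
    fun A ω => Set.indicator_apply_nonneg fun _ => zero_le_one
  have mW₁ := delEventProb_mono p hp ends hB₁
  have mW₂ := delEventProb_mono p hp ends hB₂
  have hF₁ : Monotone (𝓤₁.indicator (1 : Set V → R) * delEventProb p ends B₁) := by
    intro W W' h
    simp only [Pi.mul_apply]
    exact mul_le_mul (monotone_indicator_one_of_isUpperSet h𝓤₁ h) (mW₁ h)
      (delEventProb_nonneg p hp ends B₁ W) (nI 𝓤₁ W')
  have hF₂ : Monotone (𝓤₂.indicator (1 : Set V → R) * delEventProb p ends B₂) := by
    intro W W' h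
    simp only [Pi.mul_apply]
    exact mul_le_mul (monotone_indicator_one_of_isUpperSet h𝓤₂ h) (mW₂ h)
      (delEventProb_nonneg p hp ends B₂ W) (nI 𝓤₂ W')
  have hD₁ : Antitone (delEventProb p ends A₁) := delEventProb_anti p hp ends hA₁
  have hD₂ : Antitone (delEventProb p ends A₂) := delEventProb_anti p hp ends hA₂
  have hF₁0 : ∀ W, 0 ≤ (𝓤₁.indicator (1 : Set V → R) * delEventProb p ends B₁) W :=
    fun W => mul_nonneg (nI 𝓤₁ W) (delEventProb_nonneg p hp ends B₁ W)
  have hF₂0 : ∀ W, 0 ≤ (𝓤₂.indicator (1 : Set V → R) * delEventProb p ends B₂) W :=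
    fun W => mul_nonneg (nI 𝓤₂ W) (delEventProb_nonneg p hp ends B₂ W)
  have hD₁0 : ∀ W, 0 ≤ delEventProb p ends A₁ W := delEventProb_nonneg p hp ends A₁
  have hD₂0 : ∀ W, 0 ≤ delEventProb p ends A₂ W := delEventProb_nonneg p hp ends A₂
  have key := bhk_antitone_induced p hp ends t hF₁ hF₂ hD₁ hD₂ hF₁0 hF₂0 hD₁0 hD₂0 Finset.univ
    X Y (Finset.subset_univ _) (Finset.subset_univ _)
  simp only [REvent_univ] at key
  have e : ∀ (F : Set V → R) (A : Set (Config E)),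
      clusterObs ends Finset.univ t F * A.indicator 1 =
        fun ω => F (cluster ends ω t) * A.indicator 1 ω := by
    intro F A
    funext ω
    simp only [Pi.mul_apply, clusterObs_apply, clusterIn_univ]
  rw [e, e, e, e] at key
  simp only [Pi.mul_apply] at key
  have eL₁ : prob p (clusterInEvent ends t 𝓤₁ ∩ fibreEvent ends t (A₁ ∩ B₁) ∩
      avoidAll ends t X) ≤ expect p (fun ω => 𝓤₁.indicator (1 : Set V → R) (cluster ends ω t) *
        delEventProb p ends B₁ (cluster ends ω t) *
        delEventProb p ends A₁ (cluster ends ω t) * (avoidAll ends t X).indicator 1 ω) := by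
    rw [e1]
    refine expect_mono hp fun ω => ?_
    refine mul_le_mul_of_nonneg_right ?_ (nA _ ω)
    calc 𝓤₁.indicator (1 : Set V → R) (cluster ends ω t) *
          delEventProb p ends (A₁ ∩ B₁) (cluster ends ω t)
        ≤ 𝓤₁.indicator (1 : Set V → R) (cluster ends ω t) *
          (delEventProb p ends A₁ (cluster ends ω t) *
            delEventProb p ends B₁ (cluster ends ω t)) :=
          mul_le_mul_of_nonneg_left (delEventProb_inter_le_mul p hp ends hA₁ hB₁ _) (nI _ _)
      _ = _ := by ring
  have eL₂ : prob p (clusterInEvent ends t 𝓤₂ ∩ fibreEvent ends t (A₂ ∩ B₂) ∩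
      avoidAll ends t Y) ≤ expect p (fun ω => 𝓤₂.indicator (1 : Set V → R) (cluster ends ω t) *
        delEventProb p ends B₂ (cluster ends ω t) *
        delEventProb p ends A₂ (cluster ends ω t) * (avoidAll ends t Y).indicator 1 ω) := by
    rw [e2]
    refine expect_mono hp fun ω => ?_
    refine mul_le_mul_of_nonneg_right ?_ (nA _ ω)
    calc 𝓤₂.indicator (1 : Set V → R) (cluster ends ω t) *
          delEventProb p ends (A₂ ∩ B₂) (cluster ends ω t)
        ≤ 𝓤₂.indicator (1 : Set V → R) (cluster ends ω t) *
          (delEventProb p ends A₂ (cluster ends ω t) *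
            delEventProb p ends B₂ (cluster ends ω t)) :=
          mul_le_mul_of_nonneg_left (delEventProb_inter_le_mul p hp ends hA₂ hB₂ _) (nI _ _)
      _ = _ := by ring
  have eJ : expect p (fun ω => 𝓤₁.indicator (1 : Set V → R) (cluster ends ω t) *
      delEventProb p ends B₁ (cluster ends ω t) *
      (𝓤₂.indicator (1 : Set V → R) (cluster ends ω t) *
        delEventProb p ends B₂ (cluster ends ω t)) *
      (avoidAll ends t (X ∩ Y)).indicator 1 ω) ≤
      prob p (clusterInEvent ends t (𝓤₁ ∩ 𝓤₂) ∩ fibreEvent ends t (B₁ ∩ B₂) ∩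
        avoidAll ends t (X ∩ Y)) := by
    rw [e3]
    refine expect_mono hp fun ω => ?_
    refine mul_le_mul_of_nonneg_right ?_ (nA _ ω)
    have hind : 𝓤₁.indicator (1 : Set V → R) (cluster ends ω t) *
        𝓤₂.indicator (1 : Set V → R) (cluster ends ω t) =
        (𝓤₁ ∩ 𝓤₂).indicator (1 : Set V → R) (cluster ends ω t) := by
      by_cases h1 : cluster ends ω t ∈ 𝓤₁ <;> by_cases h2 : cluster ends ω t ∈ 𝓤₂ <;>
        simp [h1, h2]
    calc 𝓤₁.indicator (1 : Set V → R) (cluster ends ω t) *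
          delEventProb p ends B₁ (cluster ends ω t) *
          (𝓤₂.indicator (1 : Set V → R) (cluster ends ω t) *
            delEventProb p ends B₂ (cluster ends ω t))
        = (𝓤₁.indicator (1 : Set V → R) (cluster ends ω t) *
            𝓤₂.indicator (1 : Set V → R) (cluster ends ω t)) *
          (delEventProb p ends B₁ (cluster ends ω t) *
            delEventProb p ends B₂ (cluster ends ω t)) := by ring
      _ ≤ (𝓤₁ ∩ 𝓤₂).indicator (1 : Set V → R) (cluster ends ω t) *
          delEventProb p ends (B₁ ∩ B₂) (cluster ends ω t) := by
          rw [hind]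
          exact mul_le_mul_of_nonneg_left
            (delEventProb_mul_le_inter_of_isLowerSet p hp ends hB₁ hB₂ _) (nI _ _)
  have eM : expect p (fun ω => delEventProb p ends A₁ (cluster ends ω t) *
      delEventProb p ends A₂ (cluster ends ω t) * (avoidAll ends t (X ∪ Y)).indicator 1 ω) ≤
      prob p (fibreEvent ends t (A₁ ∩ A₂) ∩ avoidAll ends t (X ∪ Y)) := by
    rw [e4]
    refine expect_mono hp fun ω => ?_
    exact mul_le_mul_of_nonneg_right (delEventProb_mul_le_inter p hp ends hA₁ hA₂ _) (nA _ ω)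
  have nL₂ : 0 ≤ prob p (clusterInEvent ends t 𝓤₂ ∩ fibreEvent ends t (A₂ ∩ B₂) ∩
      avoidAll ends t Y) := prob_nonneg hp _
  have nR₁ : 0 ≤ expect p (fun ω => 𝓤₁.indicator (1 : Set V → R) (cluster ends ω t) *
      delEventProb p ends B₁ (cluster ends ω t) *
      delEventProb p ends A₁ (cluster ends ω t) * (avoidAll ends t X).indicator 1 ω) :=
    expect_nonneg hp fun ω => mul_nonneg (mul_nonneg (mul_nonneg (nI _ _)
      (delEventProb_nonneg p hp ends B₁ _)) (delEventProb_nonneg p hp ends A₁ _)) (nA _ ω)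
  have nM : 0 ≤ expect p (fun ω => delEventProb p ends A₁ (cluster ends ω t) *
      delEventProb p ends A₂ (cluster ends ω t) * (avoidAll ends t (X ∪ Y)).indicator 1 ω) :=
    expect_nonneg hp fun ω => mul_nonneg (mul_nonneg (delEventProb_nonneg p hp ends A₁ _)
      (delEventProb_nonneg p hp ends A₂ _)) (nA _ ω)
  have nJ : 0 ≤ prob p (clusterInEvent ends t (𝓤₁ ∩ 𝓤₂) ∩ fibreEvent ends t (B₁ ∩ B₂) ∩
      avoidAll ends t (X ∩ Y)) := prob_nonneg hp _
  calc prob p (clusterInEvent ends t 𝓤₁ ∩ fibreEvent ends t (A₁ ∩ B₁) ∩ avoidAll ends t X) *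
        prob p (clusterInEvent ends t 𝓤₂ ∩ fibreEvent ends t (A₂ ∩ B₂) ∩ avoidAll ends t Y)
      ≤ expect p (fun ω => 𝓤₁.indicator (1 : Set V → R) (cluster ends ω t) *
            delEventProb p ends B₁ (cluster ends ω t) *
            delEventProb p ends A₁ (cluster ends ω t) * (avoidAll ends t X).indicator 1 ω) *
          expect p (fun ω => 𝓤₂.indicator (1 : Set V → R) (cluster ends ω t) *
            delEventProb p ends B₂ (cluster ends ω t) *
            delEventProb p ends A₂ (cluster ends ω t) * (avoidAll ends t Y).indicator 1 ω) :=
        mul_le_mul eL₁ eL₂ nL₂ nR₁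
    _ ≤ expect p (fun ω => 𝓤₁.indicator (1 : Set V → R) (cluster ends ω t) *
            delEventProb p ends B₁ (cluster ends ω t) *
            (𝓤₂.indicator (1 : Set V → R) (cluster ends ω t) *
              delEventProb p ends B₂ (cluster ends ω t)) *
            (avoidAll ends t (X ∩ Y)).indicator 1 ω) *
          expect p (fun ω => delEventProb p ends A₁ (cluster ends ω t) *
            delEventProb p ends A₂ (cluster ends ω t) *
            (avoidAll ends t (X ∪ Y)).indicator 1 ω) := key
    _ ≤ prob p (clusterInEvent ends t (𝓤₁ ∩ 𝓤₂) ∩ fibreEvent ends t (B₁ ∩ B₂) ∩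
          avoidAll ends t (X ∩ Y)) *
        prob p (fibreEvent ends t (A₁ ∩ A₂) ∩ avoidAll ends t (X ∪ Y)) :=
        mul_le_mul eJ eM nM nJ

end Four

end BHKFibre

end Summit.Ventures.PercRepro2
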